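import Summits.CriticalPhenomena.PercolationContinuityZ3.Theorems.Transplant.GrigorchukCayleyLabelRigidity
import Summits.CriticalPhenomena.PercolationContinuityZ3.Theorems.Transplant.GrigorchukNoRankTwoCharacter
import Summits.CriticalPhenomena.PercolationContinuityZ3.Theorems.Transplant.AutChartOrbitsQDatum
import HarnessLib

/-!
# `Aut(Cay(𝔊; a, b, c, d)) = 𝔊`: every automorphism of the standard Cayley graph of the first Grigorchuk group is a LEFT TRANSLATION; hence the
# automorphism group is TORSION and NO node or route of the lane has its input on this graph, for ANY group of graph automorphisms

builds on p205010 (kernel theorem, internal audit signed; external expert review pending) — nothing in this file uses p205010.  This is a NEGATIVE (scope)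
record about the INPUTS of the lane's nodes on ONE graph; no percolation statement; nothing about any `@[conjecture]` (in particular nothing about
`BenjaminiSchramm1996_conj4_endState` or the residue node `…_amenableSubexponential`, MUST-NOTs stand); `θ(p_c) = 0` on `Cay(𝔊; a, b, c, d)` stays NOT PROVED
in the tree and not in print.  Lane `prim-bschramm`, seat `prim-bschramm-p3` gen 39 (DESIGN OWNER; `P3-NILPOTENT.md` §32).  Helper file
(`--supports stmt-CriticalPhenomena-4575 --as helper`).  Two small defs (`leftMulHom`, `stdCayAutEquiv`), no instance, no notation; `stdCay` = «GrigorchukCayleyLabelRigidity»'s `abbrev` for `mulCayley ↑{aG, bG, cG, dG}` (the graph of p607347 / p625451 / p621086, `rfl`).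

CONTENT.  From label rigidity («GrigorchukCayleyLabelRigidity» `stdCay_aut_mul_letter`) and `𝔊 = ⟨a, b, c, d⟩` (p606245 `closure_gens_eq_top`):
* §1 `stdCay_aut_apply (φ : stdCay ≃g stdCay) (u) : φ u = φ 1 * u`; the left translations `leftMulHom : 𝔊 →* Aut` are a BIJECTION, `stdCayAutEquiv : 𝔊 ≃* Aut`
  (the graph is a graphical regular representation of `𝔊`); `isTorsion_stdCay_aut` (Grigorchuk's torsion theorem p591617 / p615715); hence for EVERY subgroup
  `A₀ ≤ Aut` and every homomorphism `c` into a torsion-free monoid, `c = 1` (`stdCay_aut_char_eq_one`; N5a p621114 §3 needed `L(𝔊) ≤ A₀` — that binder is gone), so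
  the covering route's inputs `c g ≠ 1` / rank two («AutEndStateFC» `AutCyl.conj4_of_orbitDatum_fc`) are absent for every `A₀`;
* §2 for EVERY group `A` acting by automorphisms: `a • v = (a • 1) · v`, every additive stabiliser-killing `ψ : A → ℤ²` vanishes, hence
  `IsEmpty (AutChart.OrbitDatum stdCay A)` (the orbit theorem N3-a) AND `IsEmpty (AutChart.OrbitQDatum stdCay A)` (rung Q's quasi-step input — contrast:
  Bartholdi–Erschler's graph CARRIES such a datum, p613911);
* §3 a chart translated by an automorphism is translated by `0` (`stdCay_aut_translation_eq_zero`), so no framed chart has exact steps and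
  `IsEmpty (PlanarSkeletonFrmScaled / PlanarSkeletonFrm / PlanarSkeletonNeg / PlanarSkeletonFrmFrom stdCay)` (U_s, U, N1, N2).
Together with «GrigorchukCayleyAutNotVirtuallyNilpotent» p621086 (no virtually nilpotent group acts with finitely many orbits on any `Cay(𝔊; S)`) this covers
the inputs of the nodes U, U_s, N1, N2, the orbit theorem (N3-a), rung Q (quasi-step datum; virtually nilpotent finite-orbit action) and the covering route,
at the level of ALL automorphisms of `Cay(𝔊; a, b, c, d)` (and any route positing a graph automorphism of infinite order is void by `isTorsion_stdCay_aut`).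
Other generating sets of `𝔊` are NOT treated.
[cite: Grigorchuk1980, every element of 𝔊 has finite order; relations of 𝔊] [cite: BenjaminiSchramm1996, Conj. 4; §2 (Cayley graphs)] [cite: KozmaNitzan2024, §4 p. 16 (Lemma 8)]
[cite: LeemannDeLaSalle2022, Thm. 1.1 (context: every f.g. non-virtually-abelian group has SOME GRR; the standard generating set of 𝔊 is not treated there)]
-/

noncomputable section

namespace Summit.CriticalPhenomena.PercolationContinuityZ3.Theorems.Transplant

namespace Grigorchuk

open SimpleGraph Literature.Probability.Percolation Literature.Probability.LatticeModels
open scoped Classical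

/-! ### §1 Every automorphism is a left translation; `Aut ≅ 𝔊` is torsion; no character on any subgroup of `Aut` -/

/-- **EVERY AUTOMORPHISM OF `Cay(𝔊; a, b, c, d)` IS A LEFT TRANSLATION**: `φ u = φ 1 · u` (label rigidity + `𝔊 = ⟨a, b, c, d⟩`).  (`stdCay` is, by `rfl`
— «GrigorchukCayleyLabelRigidity» `stdCay_eq` —, the graph `mulCayley ↑{aG, bG, cG, dG}` of p607347 / p625451 / p621086.)
[cite: BenjaminiSchramm1996, §2 (Cayley graphs)] [cite: Grigorchuk1980, definition of the group] -/
theorem stdCay_aut_apply (φ : stdCay ≃g stdCay) (u : ↥grigorchukGroup) : φ u = φ 1 * u := by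
  have key : ∀ u ∈ Subgroup.closure ({aG, bG, cG, dG} : Set ↥grigorchukGroup), ∀ w : ↥grigorchukGroup, φ (w * u) = φ w * u := by
    intro u hu
    induction hu using Subgroup.closure_induction with
    | mem x hx =>
      intro w
      obtain ⟨ha, hb, hc, hd⟩ := stdCay_label_rigid φ w
      simp only [Set.mem_insert_iff, Set.mem_singleton_iff] at hx
      rcases hx with rfl | rfl | rfl | rfl
      · exact ha
      · exact hb
      · exact hc
      · exact hd
    | one => intro w; rw [mul_one, mul_one]
    | mul x y _ _ hx hy => intro w; rw [← mul_assoc, hy, hx, mul_assoc]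
    | inv x _ hx =>
      intro w
      have h := hx (w * x⁻¹)
      rw [inv_mul_cancel_right] at h
      exact eq_mul_inv_of_mul_eq h.symm
  have h := key u (by rw [closure_gens_eq_top]; trivial) 1
  rwa [one_mul] at h

/-- **The left translations, as a homomorphism `𝔊 →* Aut(Cay(𝔊; a, b, c, d))`** (`leftMulIso` of «CayleySkeletonSign»). [cite: BenjaminiSchramm1996, §2 (Cayley graphs)] -/
def leftMulHom : ↥grigorchukGroup →* (stdCay ≃g stdCay) where
  toFun g := leftMulIso ({aG, bG, cG, dG} : Finset ↥grigorchukGroup) g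
  map_one' := RelIso.ext fun x => one_mul x
  map_mul' g h := RelIso.ext fun x => mul_assoc g h x

/-- `leftMulHom g u = g · u`. [folklore] -/
@[simp] theorem leftMulHom_apply (g u : ↥grigorchukGroup) : leftMulHom g u = g * u := rfl

/-- Every automorphism is `leftMulHom (φ 1)`. [folklore] -/
theorem stdCay_aut_eq_leftMulHom (φ : stdCay ≃g stdCay) : φ = leftMulHom (φ 1) :=
  RelIso.ext fun u => by rw [leftMulHom_apply]; exact stdCay_aut_apply φ u

/-- **`g ↦ L_g` is a bijection `𝔊 → Aut(Cay(𝔊; a, b, c, d))`.** [folklore] -/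
theorem leftMulHom_bijective : Function.Bijective leftMulHom := by
  refine ⟨fun g h e => ?_, fun φ => ⟨φ 1, (stdCay_aut_eq_leftMulHom φ).symm⟩⟩
  have h1 := congrArg (fun φ : stdCay ≃g stdCay => φ 1) e
  simpa only [leftMulHom_apply, mul_one] using h1

/-- **`Aut(Cay(𝔊; a, b, c, d)) ≅ 𝔊`**: the standard Cayley graph of the first Grigorchuk group is a graphical regular representation (that `𝔊`,
like every finitely generated group that is not virtually abelian, admits SOME finite-degree GRR is Leemann–de la Salle's theorem; the standard generating
set is not treated there — this is the explicit census of «GrigorchukCayleyLabelRigidity»).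
[cite: Grigorchuk1980, definition of the group] [cite: BenjaminiSchramm1996, §2 (Cayley graphs)] [cite: LeemannDeLaSalle2022, Thm. 1.1 (context: existence of a GRR)] -/
def stdCayAutEquiv : ↥grigorchukGroup ≃* (stdCay ≃g stdCay) := MulEquiv.ofBijective leftMulHom leftMulHom_bijective

/-- **`Aut(Cay(𝔊; a, b, c, d))` IS A TORSION GROUP** (Grigorchuk's torsion theorem, kernel p591617 / p615715, transported along `g ↦ L_g`).
[cite: Grigorchuk1980, every element of 𝔊 has finite order] -/
theorem isTorsion_stdCay_aut : Monoid.IsTorsion (stdCay ≃g stdCay) := fun φ => by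
  obtain ⟨g, rfl⟩ := leftMulHom_bijective.2 φ
  exact leftMulHom.isOfFinOrder (isTorsion_grigorchukGroup g)

/-- **NO CHARACTER ON ANY SUBGROUP OF `Aut(Cay(𝔊; a, b, c, d))`**: every homomorphism from any `A₀ ≤ Aut` into a torsion-free monoid is trivial (for
subgroups CONTAINING the left translations this was «GrigorchukNoRankTwoCharacter» §3; here for every subgroup). [cite: Grigorchuk1980, every element of 𝔊 has finite order] -/
theorem stdCay_aut_char_eq_one {M : Type*} [Monoid M] [IsMulTorsionFree M] (A₀ : Subgroup (stdCay ≃g stdCay)) (c : A₀ →* M) (a : A₀) : c a = 1 :=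
  TorsionChar.subgroup_apply_eq_one isTorsion_stdCay_aut A₀ c a

/-- **Hence the rank-two input `hrank` of `AutCyl.conj4_of_orbitDatum_fc` FAILS on `Cay(𝔊; a, b, c, d)` for EVERY `A₀ ≤ Aut`** (covering / end-state leg absent
at the level of all automorphisms). [cite: BenjaminiSchramm1996, Conj. 4; §2 (Cayley graphs)] -/
theorem stdCay_not_rankTwo (A₀ : Subgroup (stdCay ≃g stdCay)) (c : A₀ →* Multiplicative (Site 2)) :
    ¬ ∃ a b : A₀, MaxArea.det2 (Multiplicative.toAdd (c a)) (Multiplicative.toAdd (c b)) ≠ 0 := by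
  rintro ⟨a, b, h⟩
  rw [stdCay_aut_char_eq_one A₀ c a, stdCay_aut_char_eq_one A₀ c b, toAdd_one, MaxArea.det2_self] at h
  exact h rfl

/-- … and so does its FC-witness input `hg : c g ≠ 1`, for EVERY `A₀ ≤ Aut`. [cite: BenjaminiSchramm1996, Conj. 4; §2 (Cayley graphs)] -/
theorem stdCay_no_char_ne_one (A₀ : Subgroup (stdCay ≃g stdCay)) (c : A₀ →* Multiplicative (Site 2)) : ¬ ∃ g : A₀, c g ≠ 1 := by
  rintro ⟨g, hg⟩
  exact hg (stdCay_aut_char_eq_one A₀ c g)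

/-! ### §2 Every group acting by automorphisms: no stabiliser-killing character, no (quasi-step) orbit datum -/

/-- An additive `ψ : A → ℤ²` on powers: `ψ (aⁿ) = n • ψ a`. [folklore] -/
theorem site2Char_pow {A : Type} [Group A] (ψ : A → Site 2) (ψ_mul : ∀ a b : A, ψ (a * b) = ψ a + ψ b) (a : A) :
    ∀ n : ℕ, ψ (a ^ n) = n • ψ a := by
  intro n
  induction n with
  | zero =>
    have e := ψ_mul 1 1
    rw [one_mul] at e
    rw [pow_zero, zero_smul]
    exact left_eq_add.1 e
  | succ n ih => rw [pow_succ, ψ_mul, ih, succ_nsmul]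

section Action

variable {A : Type} [Group A] [MulAction A ↥grigorchukGroup]

/-- **An action by automorphisms of `Cay(𝔊; a, b, c, d)` is by left translations**: `a • v = (a • 1) · v`. [cite: BenjaminiSchramm1996, §2 (Cayley graphs)] -/
theorem smul_eq_mul_of_isActionByAut (hact : IsActionByAut stdCay A) (a : A) (v : ↥grigorchukGroup) : a • v = a • (1 : ↥grigorchukGroup) * v :=
  stdCay_aut_apply { toEquiv := MulAction.toPerm a, map_rel_iff' := fun {x y} => hact a x y } v

/-- Powers act by powers: `aⁿ • v = (a • 1)ⁿ · v`. [folklore] -/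
theorem pow_smul_eq_of_isActionByAut (hact : IsActionByAut stdCay A) (a : A) (n : ℕ) :
    ∀ v : ↥grigorchukGroup, a ^ n • v = (a • (1 : ↥grigorchukGroup)) ^ n * v := by
  induction n with
  | zero => intro v; rw [pow_zero, pow_zero, one_smul, one_mul]
  | succ n ih => intro v; rw [pow_succ, mul_smul, smul_eq_mul_of_isActionByAut hact a v, ih, ← mul_assoc, ← pow_succ]

/-- **EVERY additive stabiliser-killing `ψ : A → ℤ²` of a group acting on `Cay(𝔊; a, b, c, d)` by automorphisms VANISHES** (`a` acts as `L_g`, `g = a • 1` has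
finite order `n`, so `aⁿ` fixes every vertex and `n • ψ a = ψ (aⁿ) = 0`). [cite: Grigorchuk1980, every element of 𝔊 has finite order] -/
theorem char_eq_zero_of_isActionByAut (hact : IsActionByAut stdCay A) (ψ : A → Site 2) (ψ_mul : ∀ a b : A, ψ (a * b) = ψ a + ψ b)
    (ψ_stab : ∀ (v : ↥grigorchukGroup), ∀ h ∈ MulAction.stabilizer A v, ψ h = 0) (a : A) : ψ a = 0 := by
  obtain ⟨n, hn, hgn⟩ := (isTorsion_grigorchukGroup (a • (1 : ↥grigorchukGroup))).exists_pow_eq_one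
  have hstab : a ^ n ∈ MulAction.stabilizer A (1 : ↥grigorchukGroup) := by
    rw [MulAction.mem_stabilizer_iff, pow_smul_eq_of_isActionByAut hact, hgn, one_mul]
  have h0 : n • ψ a = 0 := by rw [← site2Char_pow ψ ψ_mul a n]; exact ψ_stab 1 _ hstab
  exact (smul_eq_zero.1 h0).resolve_left hn.ne'

/-- **`Cay(𝔊; a, b, c, d)` carries NO single-step ORBIT DATUM for ANY acting group** (the input of the orbit theorem (N3-a), «AutChartOrbitsDatum»).
[cite: BenjaminiSchramm1996, Conj. 4; §2] [cite: KozmaNitzan2024, §4 p. 16 (Lemma 8)] -/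
theorem isEmpty_orbitDatum_stdCay : IsEmpty (AutChart.OrbitDatum stdCay A) := by
  refine ⟨fun D => ?_⟩
  obtain ⟨a, r, hr, -⟩ := D.cover 1
  obtain ⟨b, r', -, -, hb⟩ := D.step r hr 0 1
  rw [char_eq_zero_of_isActionByAut D.act D.ψ D.ψ_mul D.ψ_stab b] at hb
  have h0 := congrFun hb 0
  simp only [Pi.zero_apply, Pi.single_eq_same, Units.val_one, mul_one] at h0
  have h1 := D.one_le_N
  omega

/-- **`Cay(𝔊; a, b, c, d)` carries NO QUASI-STEP ORBIT DATUM for ANY acting group** (the input of rung Q's quasi-step node; Bartholdi–Erschler's graph carries one,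
p613911 — this graph does not). [cite: BenjaminiSchramm1996, Conj. 4; §2] [cite: KozmaNitzan2024, §4 p. 16 (Lemma 8)] -/
theorem isEmpty_orbitQDatum_stdCay : IsEmpty (AutChart.OrbitQDatum stdCay A) := by
  refine ⟨fun D => ?_⟩
  obtain ⟨a, r, hr, -⟩ := D.cover 1
  obtain ⟨b, r', p, -, -, hb, -⟩ := D.qstep r hr 0 1
  rw [char_eq_zero_of_isActionByAut D.act D.ψ D.ψ_mul D.ψ_stab b] at hb
  have h0 := congrFun hb 0
  simp only [Pi.zero_apply, Pi.single_eq_same, Units.val_one, mul_one] at h0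
  have h1 := D.one_le_N
  omega

end Action

/-! ### §3 No framed chart with exact steps: the single-step carriers U_s, U, N1, N2 are empty -/

/-- **An automorphism translating a chart translates it by `0`** (it has finite order). [cite: Grigorchuk1980, every element of 𝔊 has finite order] -/
theorem stdCay_aut_translation_eq_zero (φ : ↥grigorchukGroup → Site 2) (α : stdCay ≃g stdCay) (c : Site 2) (h : ∀ w, φ (α w) = φ w + c) : c = 0 := by
  obtain ⟨n, hn, hαn⟩ := (isTorsion_stdCay_aut α).exists_pow_eq_one
  have key : ∀ (k : ℕ) (w : ↥grigorchukGroup), φ ((α ^ k) w) = φ w + k • c := by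
    intro k
    induction k with
    | zero => intro w; rw [pow_zero, zero_smul, add_zero]; rfl
    | succ k ih => intro w; rw [pow_succ, RelIso.mul_apply, ih (α w), h w, add_assoc, succ_nsmul']
  have h1 := key n 1
  rw [hαn] at h1
  have h2 : n • c = 0 := by
    have : φ ((1 : stdCay ≃g stdCay) 1) = φ 1 := rfl
    rw [this] at h1
    exact (add_eq_left.1 h1.symm)
  exact (smul_eq_zero.1 h2).resolve_left hn.ne'

/-- **NO FRAMED CHART WITH EXACT STEPS on `Cay(𝔊; a, b, c, d)`.**  For every `φ : 𝔊 → ℤ²` with FRAMES (every vertex is the image of one of finitely many base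
vertices under an automorphism translating `φ`) and every `N ≥ 1`, the steps `± N eᵢ` along single edges fail somewhere: by `stdCay_aut_translation_eq_zero`
`φ` takes only the finitely many values `φ(types)`, while the steps produce infinitely many. [cite: BenjaminiSchramm1996, Conj. 4; §2] -/
theorem stdCay_no_framed_steps (φ : ↥grigorchukGroup → Site 2) (types : Finset ↥grigorchukGroup)
    (hframe : ∀ v : ↥grigorchukGroup, ∃ t ∈ types, ∃ α : stdCay ≃g stdCay, α t = v ∧ ∀ w, φ (α w) = φ w + (φ v - φ t)) (N : ℕ) (hN : 1 ≤ N) :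
    ¬ ∀ (v : ↥grigorchukGroup) (i : Fin 2) (σ : ℤˣ), ∃ v' : ↥grigorchukGroup, stdCay.Adj v v' ∧ φ v' = φ v + Pi.single i ((N : ℤ) * σ) := by
  intro hstep
  -- every value of `φ` is the value at a type
  have hval : ∀ v : ↥grigorchukGroup, ∃ t ∈ types, φ t = φ v := by
    intro v
    obtain ⟨t, ht, α, -, hα⟩ := hframe v
    refine ⟨t, ht, ?_⟩
    have h0 := stdCay_aut_translation_eq_zero φ α _ hα
    exact (sub_eq_zero.1 h0).symm
  -- the steps `+ N e₀` produce the values `φ 1 0 + k N`, all at types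
  have hseq : ∀ k : ℕ, ∃ t ∈ types, φ t 0 = φ 1 0 + k * N := by
    intro k
    induction k with
    | zero =>
      obtain ⟨t, ht, e⟩ := hval 1
      exact ⟨t, ht, by rw [e, Nat.cast_zero, zero_mul, add_zero]⟩
    | succ k ih =>
      obtain ⟨t, ht, e⟩ := ih
      obtain ⟨v', -, hv'⟩ := hstep t 0 1
      obtain ⟨t', ht', e'⟩ := hval v'
      refine ⟨t', ht', ?_⟩
      rw [e', hv', Pi.add_apply, e, Pi.single_eq_same, Units.val_one, mul_one, Nat.cast_succ]
      ring
  choose t ht hφ using hseq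
  have hinj : Function.Injective (fun k : ℕ => (⟨t k, ht k⟩ : ↥types)) := by
    intro k k' e
    have e1 : t k = t k' := congrArg Subtype.val e
    have e2 : (φ 1 0 + k * N : ℤ) = φ 1 0 + k' * N := by rw [← hφ k, ← hφ k', e1]
    have hN' : (N : ℤ) ≠ 0 := by exact_mod_cast (by omega : N ≠ 0)
    exact_mod_cast mul_right_cancel₀ hN' (add_left_cancel e2)
  exact not_injective_infinite_finite _ hinj

/-- **`Cay(𝔊; a, b, c, d)` carries NO `PlanarSkeletonFrmScaled`** (the carrier of the one-orbit scaled node U_s).  Here and below `stdCay` is, by `rfl`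
(«GrigorchukCayleyLabelRigidity» `stdCay_eq`), the graph `mulCayley ↑{aG, bG, cG, dG}` of p607347 / p625451 / p621086; no `LocallyFinite` hypothesis —
the instance is the tree's, found through the `abbrev`. [cite: BenjaminiSchramm1996, Conj. 4; §2] -/
theorem isEmpty_planarSkeletonFrmScaled_stdCay : IsEmpty (PlanarSkeletonFrmScaled stdCay) :=
  ⟨fun Φ => stdCay_no_framed_steps Φ.φ Φ.types Φ.frame Φ.N Φ.one_le_N Φ.step⟩

/-- **… NO `PlanarSkeletonFrm`** (the carrier of node U). [cite: BenjaminiSchramm1996, Conj. 4; §2] -/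
theorem isEmpty_planarSkeletonFrm_stdCay : IsEmpty (PlanarSkeletonFrm stdCay) :=
  ⟨fun Φ => stdCay_no_framed_steps Φ.φ Φ.types Φ.frame 1 le_rfl fun v i σ => by simpa only [Nat.cast_one, one_mul] using Φ.step v i σ⟩

/-- **… NO `PlanarSkeletonNeg`** (the carrier of node N1). [cite: BenjaminiSchramm1996, Conj. 4; §2] -/
theorem isEmpty_planarSkeletonNeg_stdCay : IsEmpty (PlanarSkeletonNeg stdCay) :=
  ⟨fun Φ => stdCay_no_framed_steps Φ.φ Φ.types Φ.frame 1 le_rfl fun v i σ => by simpa only [Nat.cast_one, one_mul] using Φ.step v i σ⟩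

/-- **… NO `PlanarSkeletonFrmFrom`** (the carrier of node N2). [cite: BenjaminiSchramm1996, Conj. 4; §2] -/
theorem isEmpty_planarSkeletonFrmFrom_stdCay : IsEmpty (PlanarSkeletonFrmFrom stdCay) :=
  ⟨fun Φ => stdCay_no_framed_steps Φ.φ Φ.types Φ.frame 1 le_rfl fun v i σ => by simpa only [Nat.cast_one, one_mul] using Φ.step v i σ⟩

end Grigorchuk

end Summit.CriticalPhenomena.PercolationContinuityZ3.Theorems.Transplant
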